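import Mathlib
import Literature.Topology.FourManifolds.LefschetzHandlebody
import Literature.Topology.FourManifolds.SmoothOrientation
import Literature.GroupTheory.CombinatorialGroupTheory.SignedHurwitzStabilisation
import Literature.GroupTheory.CombinatorialGroupTheory.SignedHurwitzTravel
import Literature.GroupTheory.CombinatorialGroupTheory.SignedHurwitzExchange
import HarnessLib

/-!
# Stub `stub_modelsOnFibred_of_reach` (NF4) of line `modp-braid-orbits` for crux
`ConvexBisection.AcyclicBisectionExists` (item stmt-SmoothPoincare4-10508, route
route-SmoothPoincare4-ConvexBisection): REDUCTIONS to one-step statements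

The registered stub is VERBATIM the unfolding of the named Literature fact
`Literature.Topology.FourManifolds.LefschetzBase.modelsOnFibred_of_reach`
(`LefschetzModelFacts.lean`, item 4; Gompf–Stipsicz 1999 §8.2, Baykur 2006 Lemma 1 and §5 p. 13,
Etnyre–Fuller 2006 §2 p. 5): fibred Lefschetz models `ModelsOnFibred M g l` persist along `Reach`
(signed Hurwitz moves `HurwitzStep (stdSymp ℤ g)` + stabilisation-pair moves `StabStep`).  It is an
XL formalisation (Kas' handlebody, handle slides / isotopy invariance of multi-attachments, Harer's
stabilisation, Laudenbach–Poénaru) and is NOT proved here.  Proved here, sorry-free, is the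
ALGEBRAIC part, which splits the debt into two one-step pieces and normalises the second:

* `ModelsOnFibredOfReach.reach_induction_front` — **`Reach` is generated by signed Hurwitz moves and
  FRONT stabilisations**: a move at any cut, `A ++ B ↦ embed A ++ stabBlock g c ++ embed B`
  (`c` primitive or `0`), is the front stabilisation `l ↦ stabBlock g c' ++ embed l` with
  `c' = wordProduct (stdSymp ℤ g) A c` (primitive or `0` again: the signed monodromy is invertible
  over `ℤ`, a product of transvections `t_a^{ε}` with inverses `t_a^{-ε}`) FOLLOWED BY signed
  Hurwitz moves at genus `g + 1` (`stabStep_front_orbit`): an embedded letter `(embed a, ε)` passes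
  the block leftwards by four inverse moves, fixing `(f, ±)` (`ω(embed a, f) = 0`) and turning
  `(e + embed c, ±)` into `(e + embed (t_a^{-ε} c), ±)` (`orbit_stabBlock_letter`).
* `stub_modelsOnFibred_of_reach_of` — the registered signature from (HS)
  `ModelsOnFibred M g l → HurwitzStep (stdSymp ℤ g) l l' → ModelsOnFibred M g l'` and (ST)
  `ModelsOnFibred M g l → StabStep g l l' → ModelsOnFibred M (g + 1) l'`;
  `stub_modelsOnFibred_of_reach_of_front` — from (HS) and the FRONT case of (ST) only;
  `stub_modelsOnFibred_of_reach_iff_front` — the registered signature is EQUIVALENT to (HS) ∧ (ST-front).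
  (The front cut is the one adjacent to the cap `Base g`, where the other half of Baykur's bisection
  carries no vanishing cycle.)

## Audit of the registered signature (worker, 2026-08-16) — TRUE on paper, no defect found

The truth of (HS)/(ST) depends on the product of the sign conventions (a)–(c) of
`LefschetzBasePages.lean`, re-derived independently: (a) `(ν_out, K', iK', n)` is an even permutation
of the complex-positive `(K', iK', ν_out, n = i ν_out)`, so `(K', iK', n)` is positive on `∂ Base g`
and `pageTwisting = -1` = "one less than the fibre framing" = positive critical point
(Gompf–Stipsicz §8.2 with the complex orientation; `Base g ⊂ ℂ²` literally).  (b) Letters are met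
counter-clockwise (increasing `arg w` = direction `n`; fibre ⊕ base = complex orientation for the
holomorphic `w`) in the order `n-1, …, 0`; cutting the disc along the arcs shows the boundary loop is
`ℓ_1 * ⋯ * ℓ_n` in the counter-clockwise order of the arcs at the base point, forward transport
composes as `mon(ℓ_n) ∘ ⋯ ∘ mon(ℓ_1)`, so the monodromy is `wordProduct l`, and the two elementary arc
changes on list-adjacent `(a, b)` (`b` met first) are exactly the two disjuncts of `HurwitzStep`, by
`t_a^{ε} t_b^{ε'} = t^{ε'}_{t_a^{ε} b} t_a^{ε} = t_b^{ε'} t^{ε}_{t_b^{-ε'} a}`.  (c) At the branch point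
`(ζ_{i+1}, 0)` in the holomorphic coordinate `y`: `chainLoop i` has direction `-r_in`,
`chainLoop (i+1)` has `+r_out`, `r_out² = (2g+1)2 sin(β/2) e^{i(β/2-π/2)}`,
`r_in² = (2g+1)2 sin(β/2) e^{i(π/2-β/2)}` (`β = 2π/(2g+1)`, `p'(ζ) = -(2g+1)ζ̄`), so
`Im(conj(-r_in) r_out) = ρ² cos(β/2) > 0`: a `+1`-chain for the complex orientation, matching
`stdSymp (chainVec i) (chainVec (i+1)) = 1` (non-adjacent chords of the convex `(2g+1)`-gon are
disjoint), so the chain shadow is an isometry onto `stdSymp`.  Picard–Lefschetz recomputed on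
`z₁ z₂ = t` with boundary trivialisations `zᵢ = const` near `|zᵢ| = 1`: the counter-clockwise
monodromy `z₁ ↦ z₁ e^{2πiλ(|z₁|)}` (`λ: 0 → 1` inward) turns RIGHT in the fibre orientation, and a
right-turning twist acts by `x ↦ x + ⟨δ, x⟩ δ = transvection (stdSymp ℤ g) (δ, true) x` (polar annulus:
the left-turning `(θ,t) ↦ (θ+2πt, t)` sends the outward ray `b` to `b + a` with `⟨a, b⟩ = -1`).
Hence `HurwitzStep` is the shadow of the geometric moves and (HS) holds (same fibration, re-chosen
arcs).  (ST): for `l = A ++ B`, `M = X(F;A) ∪_Y X(F;B)` (cap in the `B` disc); a positive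
stabilisation of the common open book on `Y = ∂X(F;A)` is a cancelling pair with a `pf-1` (positive)
handle from `X(F;A)` and, `∂X(F;B)` being `-Y`, with a `pf+1` (negative) handle from `X(F;B)`; twice
(binding connected again, Baykur Lemma 1) this inserts counter-clockwise `B, γ₁⁻, γ₂⁻ | γ₂⁺, γ₁⁺, A`,
i.e. `A ++ [(γ₁,+),(γ₂,+),(γ₂,-),(γ₁,-)] ++ B`, `Y''`-monodromy `μ_A t_{γ₁} t_{γ₂}`; `[γ₂] = f`,
`[γ₁] = e + c♯` (`c♯` dual to the first arc, primitive or `0`), and the identification of the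
stabilised page with the page of `Base (g+1)` extending the old one can be chosen (`SL₂(ℤ)` acts on
the new pair) with `(e, f) = (newE, newF)`, old classes `↦ embed`: exactly `stabBlock`.  The new
2-handlebody is `X(F;l) ♮ 2(S² × D²)` (slide `γᵢ⁻` over `γᵢ⁺`, cancel the 1-handle: a split `0`-framed
unknot), `μ_A μ_B = 1` still, and the closed-up manifold is `M` by Laudenbach–Poénaru.  `c = 0` is
fine (the second arc still joins the two boundary circles).  Degenerate data: `g = 0` (all classes `0`,
`HurwitzStep` a transposition: true); class-`0` letters at `g ≥ 1` are null-homotopic cycles, fine for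
both moves; the `Classical.epsilon` junk of `shadowMap` cannot be exhibited (its specification is
satisfiable, Milnor 1968 Thm 9.1).  Verdict: `stub-blocked` on `LefschetzBase.modelsOnFibred_of_reach`.
-/

noncomputable section

-- the prescribed namespace `Summit.<P>.<Sub>.…` duplicates `SmoothPoincare4` (P = Sub)
set_option linter.dupNamespace false

open scoped Manifold ContDiff Topology

namespace Summit.SmoothPoincare4.SmoothPoincare4.Theorems.AcyclicBisectionExists.ModpBraidOrbits

open Literature.GroupTheory.CombinatorialGroupTheory.SignedHurwitz
open Literature.Topology.FourManifolds Literature.Topology.FourManifolds.LefschetzBase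

namespace ModelsOnFibredOfReach

variable {n : ℕ}

/-! ## §1 Opposite transvections cancel; the signed monodromy keeps arc classes primitive -/

/-- `sgn (¬s) = -sgn s`. [folklore] -/
theorem sgn_not (s : Bool) : (sgn (!s) : ℤ) = -sgn s := by
  cases s <;> simp

/-- Opposite signed transvections along the same class cancel: `T_v^{ε} (T_v^{-ε} y) = y`
(`stdSymp ℤ n` is alternating). [folklore] -/
theorem transvection_not_apply (v : Fin n ⊕ Fin n → ℤ) (s : Bool) (y : Fin n ⊕ Fin n → ℤ) :
    transvection (stdSymp ℤ n) (v, s) (transvection (stdSymp ℤ n) (v, !s) y) = y := by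
  rw [transvection_apply, transvection_apply]
  dsimp only
  rw [map_add, map_smul, smul_eq_mul, stdSymp_int_self, mul_zero, add_zero, sgn_not, neg_mul,
    neg_smul, add_assoc, neg_add_cancel, add_zero]

/-- Opposite signed transvections cancel, the other way round: `T_v^{-ε} (T_v^{ε} y) = y`.
[folklore] -/
theorem transvection_apply_not (v : Fin n ⊕ Fin n → ℤ) (s : Bool) (y : Fin n ⊕ Fin n → ℤ) :
    transvection (stdSymp ℤ n) (v, !s) (transvection (stdSymp ℤ n) (v, s) y) = y := by
  have h := transvection_not_apply v (!s) y
  rwa [Bool.not_not] at h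

/-- Divisibility transport through the signed monodromy of a word: if `W(A) c` is divisible by `d`
then so is `c` (peel off one invertible transvection at a time). [folklore] -/
theorem exists_eq_smul_of_wordProduct_eq_smul (A : IntWord n) :
    ∀ (c w : Fin n ⊕ Fin n → ℤ) (d : ℤ), wordProduct (stdSymp ℤ n) A c = d • w →
      ∃ w' : Fin n ⊕ Fin n → ℤ, c = d • w' := by
  induction A with
  | nil =>
    intro c w d h
    exact ⟨w, by simpa using h⟩
  | cons a A ih =>
    intro c w d h
    obtain ⟨v, s⟩ := a
    rw [wordProduct_cons, Module.End.mul_apply] at h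
    refine ih c (transvection (stdSymp ℤ n) (v, !s) w) d ?_
    rw [← map_smul, ← h, transvection_apply_not]

/-- The signed monodromy of a word preserves primitivity (it is an automorphism of `ℤ^{2n}`).
[folklore] -/
theorem isPrimitive_wordProduct (A : IntWord n) {c : Fin n ⊕ Fin n → ℤ} (hc : IsPrimitive c) :
    IsPrimitive (wordProduct (stdSymp ℤ n) A c) := by
  intro d hd
  have hd' : ∀ i, ∃ k, wordProduct (stdSymp ℤ n) A c i = d * k := fun i => hd i
  choose w hw using hd'
  obtain ⟨w', hw'⟩ := exists_eq_smul_of_wordProduct_eq_smul A c w d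
    (funext fun i => by rw [hw i, Pi.smul_apply, smul_eq_mul])
  exact hc d fun i => ⟨w' i, by rw [hw', Pi.smul_apply, smul_eq_mul]⟩

/-- "Primitive or zero" is preserved by the signed monodromy of any word. [folklore] -/
theorem zero_or_isPrimitive_wordProduct (A : IntWord n) {c : Fin n ⊕ Fin n → ℤ}
    (hc : c = 0 ∨ IsPrimitive c) :
    wordProduct (stdSymp ℤ n) A c = 0 ∨ IsPrimitive (wordProduct (stdSymp ℤ n) A c) := by
  rcases hc with rfl | hc
  · exact Or.inl (map_zero _)
  · exact Or.inr (isPrimitive_wordProduct A hc)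

/-! ## §2 Moving the stabilisation block through embedded letters by signed Hurwitz moves -/

/-- Inverse move of an embedded letter `(embed v, s)` past an `e`-letter of the block:
`(e + embed c) - ε ω(embed v, e + embed c) • embed v = e + embed (t_v^{-ε} c)`. [folklore] -/
theorem passE_sub (c v : Fin n ⊕ Fin n → ℤ) (s : Bool) :
    newE n + embed n c -
        (sgn s * stdSymp ℤ (n + 1) (embed n v) (newE n + embed n c)) • embed n v =
      newE n + embed n (transvection (stdSymp ℤ n) (v, !s) c) := by
  rw [transvection_apply]
  dsimp only
  rw [map_add, stdSymp_embed_newE, stdSymp_embed_embed, zero_add, embed_add, embed_smul, sgn_not,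
    neg_mul, neg_smul, ← sub_eq_add_neg, add_sub_assoc]

/-- Inverse move of an embedded letter past an `f`-letter of the block: `f` is unchanged
(`ω(embed v, f) = 0`). [folklore] -/
theorem passF_sub (v : Fin n ⊕ Fin n → ℤ) (s : Bool) :
    newF n - (sgn s * stdSymp ℤ (n + 1) (embed n v) (newF n)) • embed n v = newF n := by
  simp [stdSymp_embed_newF]

/-- **An embedded letter passes the block from right to left** (four inverse Hurwitz moves):
`pre ++ block(c) ++ (embed v, ε) :: rest ↝ pre ++ (embed v, ε) :: block(t_v^{-ε} c) ++ rest`.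
[folklore] -/
theorem orbit_stabBlock_letter (c : Fin n ⊕ Fin n → ℤ) (x : (Fin n ⊕ Fin n → ℤ) × Bool)
    (pre rest : IntWord (n + 1)) :
    HurwitzOrbit (stdSymp ℤ (n + 1)) (pre ++ (stabBlock n c ++ (embed n x.1, x.2) :: rest))
      (pre ++ (embed n x.1, x.2) ::
        (stabBlock n (transvection (stdSymp ℤ n) (x.1, !x.2) c) ++ rest)) := by
  obtain ⟨v, s⟩ := x
  -- the classes produced verbatim by the inverse move `(a, b) ↦ (b, (a.1 - ε_b ω(b.1, a.1) • b.1, a.2))`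
  let E : Fin (n + 1) ⊕ Fin (n + 1) → ℤ := newE n + embed n c
  let F : Fin (n + 1) ⊕ Fin (n + 1) → ℤ := newF n
  let y : (Fin (n + 1) ⊕ Fin (n + 1) → ℤ) × Bool := (embed n v, s)
  let D : Fin (n + 1) ⊕ Fin (n + 1) → ℤ := E - (sgn s * stdSymp ℤ (n + 1) (embed n v) E) • embed n v
  let F₁ : Fin (n + 1) ⊕ Fin (n + 1) → ℤ :=
    F - (sgn s * stdSymp ℤ (n + 1) (embed n v) F) • embed n v
  have h1 : HurwitzStep (stdSymp ℤ (n + 1))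
      (pre ++ ((E, true) :: (F, true) :: (F, false) :: (E, false) :: y :: rest))
      (pre ++ ((E, true) :: (F, true) :: (F, false) :: y :: (D, false) :: rest)) :=
    ⟨pre ++ [(E, true), (F, true), (F, false)], rest, (E, false), y,
      by simp only [List.append_assoc, List.cons_append, List.nil_append],
      Or.inr (by simp only [List.append_assoc, List.cons_append, List.nil_append, y, D])⟩
  have h2 : HurwitzStep (stdSymp ℤ (n + 1))
      (pre ++ ((E, true) :: (F, true) :: (F, false) :: y :: (D, false) :: rest))
      (pre ++ ((E, true) :: (F, true) :: y :: (F₁, false) :: (D, false) :: rest)) :=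
    ⟨pre ++ [(E, true), (F, true)], (D, false) :: rest, (F, false), y,
      by simp only [List.append_assoc, List.cons_append, List.nil_append],
      Or.inr (by simp only [List.append_assoc, List.cons_append, List.nil_append, y, F₁])⟩
  have h3 : HurwitzStep (stdSymp ℤ (n + 1))
      (pre ++ ((E, true) :: (F, true) :: y :: (F₁, false) :: (D, false) :: rest))
      (pre ++ ((E, true) :: y :: (F₁, true) :: (F₁, false) :: (D, false) :: rest)) :=
    ⟨pre ++ [(E, true)], (F₁, false) :: (D, false) :: rest, (F, true), y,
      by simp only [List.append_assoc, List.cons_append, List.nil_append],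
      Or.inr (by simp only [List.append_assoc, List.cons_append, List.nil_append, y, F₁])⟩
  have h4 : HurwitzStep (stdSymp ℤ (n + 1))
      (pre ++ ((E, true) :: y :: (F₁, true) :: (F₁, false) :: (D, false) :: rest))
      (pre ++ (y :: (D, true) :: (F₁, true) :: (F₁, false) :: (D, false) :: rest)) :=
    ⟨pre, (F₁, true) :: (F₁, false) :: (D, false) :: rest, (E, true), y, rfl,
      Or.inr (by simp only [y, D])⟩
  have H : HurwitzOrbit (stdSymp ℤ (n + 1))
      (pre ++ ((E, true) :: (F, true) :: (F, false) :: (E, false) :: y :: rest))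
      (pre ++ (y :: (D, true) :: (F₁, true) :: (F₁, false) :: (D, false) :: rest)) :=
    h1.orbit.trans (h2.orbit.trans (h3.orbit.trans h4.orbit))
  have hD : D = newE n + embed n (transvection (stdSymp ℤ n) (v, !s) c) := passE_sub c v s
  have hF : F₁ = newF n := passF_sub v s
  rw [hD, hF] at H
  exact H

/-- **The block passes an embedded word from left to right**:
`pre ++ block(W(A) c) ++ embed A ++ rest ↝ pre ++ embed A ++ block(c) ++ rest`
(letter by letter; passing `(a, ε)` replaces the arc class `x` by `t_a^{-ε} x`). [folklore] -/
theorem orbit_stabBlock_mapWord (A : IntWord n) :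
    ∀ (c : Fin n ⊕ Fin n → ℤ) (pre rest : IntWord (n + 1)),
      HurwitzOrbit (stdSymp ℤ (n + 1))
        (pre ++ (stabBlock n (wordProduct (stdSymp ℤ n) A c) ++ (mapWord (embed n) A ++ rest)))
        (pre ++ (mapWord (embed n) A ++ (stabBlock n c ++ rest))) := by
  induction A with
  | nil =>
    intro c pre rest
    simp only [mapWord_nil, List.nil_append, wordProduct_nil, Module.End.one_apply]
    exact HurwitzOrbit.refl _ _
  | cons a A ih =>
    intro c pre rest
    obtain ⟨v, s⟩ := a
    have h1 := orbit_stabBlock_letter (wordProduct (stdSymp ℤ n) ((v, s) :: A) c) (v, s) pre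
      (mapWord (embed n) A ++ rest)
    have e : transvection (stdSymp ℤ n) (v, !s) (wordProduct (stdSymp ℤ n) ((v, s) :: A) c) =
        wordProduct (stdSymp ℤ n) A c := by
      rw [wordProduct_cons, Module.End.mul_apply, transvection_apply_not]
    rw [e] at h1
    have h2 := ih c (pre ++ [(embed n v, s)]) rest
    simp only [List.append_assoc, List.cons_append, List.nil_append] at h2
    rw [mapWord_cons, List.cons_append]
    exact h1.trans h2

/-- **From a FRONT stabilisation to any cut by signed Hurwitz moves**:
`block(W(A) c) ++ embed (A ++ B) ↝ embed A ++ block(c) ++ embed B`. [folklore] -/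
theorem orbit_front_to_cut (A B : IntWord n) (c : Fin n ⊕ Fin n → ℤ) :
    HurwitzOrbit (stdSymp ℤ (n + 1))
      (stabBlock n (wordProduct (stdSymp ℤ n) A c) ++ mapWord (embed n) (A ++ B))
      (mapWord (embed n) A ++ stabBlock n c ++ mapWord (embed n) B) := by
  simpa only [List.nil_append, mapWord_append, List.append_assoc] using
    orbit_stabBlock_mapWord A c [] (mapWord (embed n) B)

/-- A front stabilisation is a stabilisation-pair move (cut `[] ++ l`). [folklore] -/
theorem stabStep_front {l : IntWord n} {c : Fin n ⊕ Fin n → ℤ} (hc : c = 0 ∨ IsPrimitive c) :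
    StabStep n l (stabBlock n c ++ mapWord (embed n) l) :=
  ⟨[], l, c, hc, rfl, by simp⟩

/-- **Every stabilisation-pair move is a FRONT stabilisation followed by signed Hurwitz moves at
the new genus** (the arc class is transported by the invertible monodromy `W(A)` of the prefix, which
keeps it primitive-or-zero). [folklore] -/
theorem stabStep_front_orbit {l : IntWord n} {l' : IntWord (n + 1)} (h : StabStep n l l') :
    ∃ c : Fin n ⊕ Fin n → ℤ, (c = 0 ∨ IsPrimitive c) ∧
      HurwitzOrbit (stdSymp ℤ (n + 1)) (stabBlock n c ++ mapWord (embed n) l) l' := by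
  obtain ⟨A, B, c, hc, rfl, rfl⟩ := h
  exact ⟨wordProduct (stdSymp ℤ n) A c, zero_or_isPrimitive_wordProduct A hc, orbit_front_to_cut A B c⟩

/-! ## §3 `Reach` is generated by signed Hurwitz moves and front stabilisations -/

/-- **`Reach` is generated by signed Hurwitz moves and FRONT stabilisations**: a property of
(genus, word) pairs that holds at `(g, l)`, is stable under signed Hurwitz moves at every genus and
under front stabilisations `l' ↦ stabBlock g' c ++ embed l'` (`c` primitive or `0`) holds at every
pair reachable from `(g, l)`. [folklore] -/
theorem reach_induction_front {P : (g : ℕ) → IntWord g → Prop}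
    (hH : ∀ (g' : ℕ) (l' l'' : IntWord g'), P g' l' → HurwitzStep (stdSymp ℤ g') l' l'' → P g' l'')
    (hS : ∀ (g' : ℕ) (l' : IntWord g') (c : Fin g' ⊕ Fin g' → ℤ), (c = 0 ∨ IsPrimitive c) →
      P g' l' → P (g' + 1) (stabBlock g' c ++ mapWord (embed g') l'))
    {g : ℕ} {l : IntWord g} {g' : ℕ} {l' : IntWord g'} (h : Reach g l g' l') (h0 : P g l) :
    P g' l' := by
  have hO : ∀ (k : ℕ) (w w' : IntWord k), HurwitzOrbit (stdSymp ℤ k) w w' → P k w → P k w' := by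
    intro k w w' hww' hw
    unfold HurwitzOrbit at hww'
    induction hww' with
    | refl => exact hw
    | tail _ hst ih => exact hH k _ _ ih hst
  induction h with
  | refl => exact h0
  | hurwitz _ hst ih => exact hH _ _ _ ih hst
  | stab _ hst ih =>
    obtain ⟨c, hc, horb⟩ := stabStep_front_orbit hst
    exact hO _ _ _ horb (hS _ _ c hc ih)

end ModelsOnFibredOfReach

open ModelsOnFibredOfReach

/-! ## §4 The registered signature from the one-step statements -/

/-- **Reduction of the registered stub `stub_modelsOnFibred_of_reach`
(= `LefschetzBase.modelsOnFibred_of_reach`, NF4) to its two one-step statements**: (HS) fibred models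
persist under ONE signed Hurwitz move at the current genus (Gompf–Stipsicz 1999 §8.2: re-choice of one
arc of the same fibration, handle slides) and (ST) under ONE stabilisation-pair move (Etnyre–Fuller
2006 §2 p. 5 with Baykur 2006 Lemma 1).  The conclusion is the registered signature verbatim;
induction on `Reach`. [folklore] -/
theorem stub_modelsOnFibred_of_reach_of :
    (∀ (M : Type) [TopologicalSpace M] [T2Space M] [SecondCountableTopology M]
      [ChartedSpace (EuclideanSpace ℝ (Fin 4)) M] [IsManifold (𝓡 4) ∞ M] (g : ℕ) (l l' : IntWord g),
      ModelsOnFibred M g l → HurwitzStep (stdSymp ℤ g) l l' → ModelsOnFibred M g l') →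
    (∀ (M : Type) [TopologicalSpace M] [T2Space M] [SecondCountableTopology M]
      [ChartedSpace (EuclideanSpace ℝ (Fin 4)) M] [IsManifold (𝓡 4) ∞ M] (g : ℕ) (l : IntWord g)
      (l' : IntWord (g + 1)), ModelsOnFibred M g l → StabStep g l l' → ModelsOnFibred M (g + 1) l') →
    ∀ (M : Type) [TopologicalSpace M] [T2Space M] [SecondCountableTopology M]
      [ChartedSpace (EuclideanSpace ℝ (Fin 4)) M] [IsManifold (𝓡 4) ∞ M] (g : ℕ) (l : IntWord g)
      (g' : ℕ) (l' : IntWord g'),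
      ModelsOnFibred M g l → Reach g l g' l' → ModelsOnFibred M g' l' := by
  intro hHS hST M _ _ _ _ _ g l g' l' hM h
  induction h with
  | refl => exact hM
  | hurwitz _ hst ih => exact hHS M _ _ _ ih hst
  | stab _ hst ih => exact hST M _ _ _ ih hst

/-- **Reduction of the registered stub to (HS) and the FRONT stabilisation only**: it suffices that
fibred models persist under one signed Hurwitz move and under the stabilisation-pair move at the cut
in front of the word, `l ↦ stabBlock g c ++ embed l` (`c` primitive or `0`) — every other cut is a
front stabilisation with the transported arc class `W(A) c` followed by signed Hurwitz moves at genus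
`g + 1` (`ModelsOnFibredOfReach.stabStep_front_orbit`).  Conclusion: the registered signature
verbatim. [folklore] -/
theorem stub_modelsOnFibred_of_reach_of_front :
    (∀ (M : Type) [TopologicalSpace M] [T2Space M] [SecondCountableTopology M]
      [ChartedSpace (EuclideanSpace ℝ (Fin 4)) M] [IsManifold (𝓡 4) ∞ M] (g : ℕ) (l l' : IntWord g),
      ModelsOnFibred M g l → HurwitzStep (stdSymp ℤ g) l l' → ModelsOnFibred M g l') →
    (∀ (M : Type) [TopologicalSpace M] [T2Space M] [SecondCountableTopology M]
      [ChartedSpace (EuclideanSpace ℝ (Fin 4)) M] [IsManifold (𝓡 4) ∞ M] (g : ℕ) (l : IntWord g)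
      (c : Fin g ⊕ Fin g → ℤ), (c = 0 ∨ IsPrimitive c) → ModelsOnFibred M g l →
      ModelsOnFibred M (g + 1) (stabBlock g c ++ mapWord (embed g) l)) →
    ∀ (M : Type) [TopologicalSpace M] [T2Space M] [SecondCountableTopology M]
      [ChartedSpace (EuclideanSpace ℝ (Fin 4)) M] [IsManifold (𝓡 4) ∞ M] (g : ℕ) (l : IntWord g)
      (g' : ℕ) (l' : IntWord g'),
      ModelsOnFibred M g l → Reach g l g' l' → ModelsOnFibred M g' l' := by
  intro hHS hSTfront M _ _ _ _ _ g l g' l' hM h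
  exact reach_induction_front (P := fun k w => ModelsOnFibred M k w)
    (fun k w w' hw hst => hHS M k w w' hw hst) (fun k w c hc hw => hSTfront M k w c hc hw) h hM

/-- **Normal form of the debt NF4**: the registered signature is EQUIVALENT to the conjunction of
the one-step statement (HS) and the front one-step statement (ST-front) (`→`: one Hurwitz move,
resp. one front stabilisation, is a `Reach` step; `←`: `stub_modelsOnFibred_of_reach_of_front`).
[folklore] -/
theorem stub_modelsOnFibred_of_reach_iff_front :
    (∀ (M : Type) [TopologicalSpace M] [T2Space M] [SecondCountableTopology M]
      [ChartedSpace (EuclideanSpace ℝ (Fin 4)) M] [IsManifold (𝓡 4) ∞ M] (g : ℕ) (l : IntWord g)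
      (g' : ℕ) (l' : IntWord g'),
      ModelsOnFibred M g l → Reach g l g' l' → ModelsOnFibred M g' l') ↔
    ((∀ (M : Type) [TopologicalSpace M] [T2Space M] [SecondCountableTopology M]
        [ChartedSpace (EuclideanSpace ℝ (Fin 4)) M] [IsManifold (𝓡 4) ∞ M] (g : ℕ) (l l' : IntWord g),
        ModelsOnFibred M g l → HurwitzStep (stdSymp ℤ g) l l' → ModelsOnFibred M g l') ∧
      ∀ (M : Type) [TopologicalSpace M] [T2Space M] [SecondCountableTopology M]
        [ChartedSpace (EuclideanSpace ℝ (Fin 4)) M] [IsManifold (𝓡 4) ∞ M] (g : ℕ) (l : IntWord g)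
        (c : Fin g ⊕ Fin g → ℤ), (c = 0 ∨ IsPrimitive c) → ModelsOnFibred M g l →
        ModelsOnFibred M (g + 1) (stabBlock g c ++ mapWord (embed g) l)) := by
  constructor
  · intro h
    exact ⟨fun M _ _ _ _ _ g l l' hM hst => h M g l g l' hM ((Reach.refl g l).hurwitz hst),
      fun M _ _ _ _ _ g l c hc hM => h M g l (g + 1) _ hM (stabStep_front hc).reach⟩
  · rintro ⟨hHS, hST⟩
    exact stub_modelsOnFibred_of_reach_of_front hHS hST

end Summit.SmoothPoincare4.SmoothPoincare4.Theorems.AcyclicBisectionExists.ModpBraidOrbits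

end
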